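import Mathlib
import Literature.Computability.AlgebraicComplexity.NewtonPolygonTauProductBounds
import Summits.ValiantsHypothesis.ValiantsHypothesis.Theorems.NewtonUnitEquationsTwoProductsFormalLogLinearisationLiftedPairDegreeTwo
import Summits.ValiantsHypothesis.ValiantsHypothesis.Theorems.NewtonUnitEquationsTwoProductsFormalLogLinearisationLiftedPairTools

/-!
# Crux `TwoProducts` (stmt-ValiantsHypothesis-5906), line `formal-log-linearisation`: `LiftedPencilCount` at `m = 2` is LINEAR

Sequel to `…FormalLogLinearisationLiftedPairDegreeTwo.lean` (`minimal_totalDegree_le_two`: for two points against two points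
in `ℂ^s`, every componentwise-minimal element of `{G ≠ 0}` has total degree `≤ 2`; `liftedPencilCount_two`: `≤ (s+2)²`).
Here the count is made LINEAR, confirming at `m = 2` the linear shape `(2m−1)(s−1)+1` conjectured in the theory memo
`memo-logSumEngine-core.md` (val-width-0318-p2), up to an additive constant:

* `liftedPencilCount_two_linear` — for `A, B : Fin 2 → Fin s → ℂ` and any 2-pencil of positive real gradings, a finite set
  of pencil-visible multi-indices has at most `3·s` elements.

Proof.  A pencil-visible `μ` has `|μ| ≤ 2`.  Singles `e_i` and doubles `2e_i` charge injectively to `i` (they cannot both be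
visible: `e_i` would be lighter than `2e_i` and lie in `{G ≠ 0}`), `≤ s` in all.  For a visible pair `μ = e_i + e_k`, `i ≠ k`,
both coordinates are dead (`A₀+A₁ = B₀+B₁`, parallelogram normal form `u = B₀−A₀`, `v = B₁−A₀`, `G(e_a+e_b) = u_a v_b + u_b v_a`,
`G(2e_a) = 2u_a v_a` on dead coordinates) and, up to symmetry, `u_i v_k ≠ 0`.  If `v_i = 0` then `i` is the STRICT minimiser of
the grading over `𝒳 = {dead, u ≠ 0, v = 0}` and `k` over `𝒱 = {dead, v ≠ 0}` (the competitors `e_{i'}+e_k`, `e_i+e_{k'}` lie in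
`{G ≠ 0}`); if `v_i ≠ 0` then `2e_i ∈ {G ≠ 0}` forces `ℓ_k < ℓ_i`, whence `u_k = 0` (else `2e_k` is lighter), and `k`, `i` are the
strict minimisers over `𝒴 = {dead, u = 0 ≠ v}`, `𝒰 = {dead, u ≠ 0}`.  So the planar image `P i + P k` (`P i = (θ₁ i, θ₂ i)`) is a
STRICT TOP of the Minkowski sum `P(𝒳) + P(𝒱)` or `P(𝒰) + P(𝒴)` for the weight `(−1, −c)` — by the tree's planar toolkit
(`KPTT.PlanarMinkowski.IsStrictTop.add`, `.mem_extremePoints`) an extreme point of its hull, of which there are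
`≤ #vert + #vert ≤ |𝒳| + |𝒱|`, resp. `|𝒰| + |𝒴|` (`ncard_extremePoints_add_le`, `ncard_extremePoints_le_card`) — and the planar
image is injective on visible sets.  Total `≤ s + s + s`.

Honest framing: an UNCONDITIONAL theorem about the engine's LIFTED NECESSARY condition at `m = 2` only; it does NOT bound the
engine `LogSumEngine` (fibre cancellation untouched) and says nothing for `m ≥ 3` (where the XOR design of the seat's note,
evidence n°52 on 5906, shows that minimality alone cannot work); engine and crux `TwoProducts` are OPEN; nothing here bears on
`VP ≠ VNP`.
-/

set_option linter.dupNamespace false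

noncomputable section

open scoped BigOperators Pointwise
open Literature.Computability.AlgebraicComplexity.KPTT.PlanarMinkowski (ncard_extremePoints_add_le ncard_extremePoints_le_card)

namespace Summit.ValiantsHypothesis.ValiantsHypothesis.Theorems.NewtonUnitEquations.TwoProducts.FormalLogLinearisation

/-! ## The linear count -/

/-- **`LiftedPencilCount` at `m = 2` is linear: `#S ≤ 3s`.**  For two points against two points in `ℂ^s` and any 2-pencil of
positive real gradings, a finite set of pencil-visible multi-indices has at most `3·s` elements (memo signature with `m = 2`).
[folklore] -/
theorem liftedPencilCount_two_linear {s : ℕ} (A B : Fin 2 → Fin s → ℂ) (θ₁ θ₂ : Fin s → ℝ)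
    (hθ₁ : ∀ i, 0 < θ₁ i) (hθ₂ : ∀ i, 0 < θ₂ i) (S : Finset (Fin s → ℕ))
    (hS : ∀ μ ∈ S, (∑ j, ∏ i, A j i ^ μ i) ≠ (∑ j, ∏ i, B j i ^ μ i) ∧
      ∃ c : ℝ, 0 < c ∧ ∀ ν : Fin s → ℕ, ν ≠ μ →
        (∑ j, ∏ i, A j i ^ ν i) ≠ (∑ j, ∏ i, B j i ^ ν i) →
          ∑ i, (θ₁ i + c * θ₂ i) * (μ i : ℝ) < ∑ i, (θ₁ i + c * θ₂ i) * (ν i : ℝ)) :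
    S.card ≤ 3 * s := by
  classical
  -- shorthand for `G ν ≠ 0`
  set Zc : (Fin s → ℕ) → Prop := fun ν => (∑ j, ∏ i, A j i ^ ν i) ≠ (∑ j, ∏ i, B j i ^ ν i) with hZc
  -- (0) pencil-visible ⇒ componentwise-minimal ⇒ total degree ≤ 2
  have hminimal : ∀ μ ∈ S, ∀ ν : Fin s → ℕ, ν ≤ μ → ν ≠ μ →
      (∑ j, ∏ i, A j i ^ ν i) = (∑ j, ∏ i, B j i ^ ν i) := by
    intro μ hμ ν hle hne
    obtain ⟨-, c, hc, hmin⟩ := hS μ hμ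
    by_contra hGν
    have hlt := hmin ν hne hGν
    have hle' : ∑ i, (θ₁ i + c * θ₂ i) * (ν i : ℝ) ≤ ∑ i, (θ₁ i + c * θ₂ i) * (μ i : ℝ) :=
      Finset.sum_le_sum fun i _ => by
        have h1 : (0 : ℝ) ≤ θ₁ i + c * θ₂ i := by have := hθ₁ i; have := hθ₂ i; positivity
        exact mul_le_mul_of_nonneg_left (by exact_mod_cast hle i) h1
    linarith
  have hdeg : ∀ μ ∈ S, ∑ i, μ i ≤ 2 := fun μ hμ =>
    minimal_totalDegree_le_two A B μ (hS μ hμ).1 (hminimal μ hμ)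
  -- unit vectors below a pair are dead
  have hdead_of_pair : ∀ μ ∈ S, ∀ i k : Fin s, i ≠ k → μ = Pi.single i 1 + Pi.single k 1 →
      A 0 i + A 1 i = B 0 i + B 1 i := by
    intro μ hμ i k hik hμe
    have hle : (Pi.single i 1 : Fin s → ℕ) ≤ μ := fun l => by
      rw [hμe, Pi.add_apply]; exact Nat.le_add_right _ _
    have hne : (Pi.single i 1 : Fin s → ℕ) ≠ μ := by
      intro h
      have := congrFun h k
      rw [hμe, Pi.add_apply, Pi.single_eq_of_ne (Ne.symm hik), Pi.single_eq_same] at this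
      omega
    have h := hminimal μ hμ _ hle hne
    simp only [Fin.sum_univ_two, prod_pow_single, pow_one] at h
    exact h
  -- planar points, weights, the planar image of a multi-index
  set P : Fin s → (Fin 2 → ℝ) := fun i => ![θ₁ i, θ₂ i] with hP
  have hwP : ∀ (c : ℝ) (i : Fin s), ![-1, -c] ⬝ᵥ P i = -(θ₁ i + c * θ₂ i) := fun c i => weight_point θ₁ θ₂ c i
  set π : (Fin s → ℕ) → (Fin 2 → ℝ) := fun μ => ∑ i, (μ i : ℝ) • P i with hπ
  have hπ_pair : ∀ i k : Fin s, π (Pi.single i 1 + Pi.single k 1) = P i + P k := by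
    intro i k
    have hsingle : ∀ a : Fin s, ∑ l, ((Pi.single a 1 : Fin s → ℕ) l : ℝ) • P l = P a := by
      intro a
      rw [Finset.sum_eq_single a (fun l _ hl => by rw [Pi.single_eq_of_ne hl, Nat.cast_zero, zero_smul])
        (fun h => absurd (Finset.mem_univ a) h), Pi.single_eq_same, Nat.cast_one, one_smul]
    simp only [hπ, Pi.add_apply, Nat.cast_add, add_smul, Finset.sum_add_distrib, hsingle]
  have hwπ : ∀ (c : ℝ) (μ : Fin s → ℕ), ![-1, -c] ⬝ᵥ π μ = -∑ i, (θ₁ i + c * θ₂ i) * (μ i : ℝ) := by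
    intro c μ
    rw [hπ, dotProduct_sum, ← Finset.sum_neg_distrib]
    refine Finset.sum_congr rfl fun i _ => ?_
    rw [dotProduct_smul, hwP, smul_eq_mul]; ring
  -- π is injective on `S` (two visible points with the same planar image would tie)
  have hπinj : Set.InjOn π ↑S := by
    intro μ hμ μ' hμ' hππ
    by_contra hne
    obtain ⟨-, c, -, hmin⟩ := hS μ hμ
    obtain ⟨hG', -, -, -⟩ := hS μ' hμ'
    have hlt := hmin μ' (Ne.symm hne) hG'
    have h1 := hwπ c μ
    have h2 := hwπ c μ'
    rw [hππ] at h1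
    linarith
  -- index classes on dead coordinates (parallelogram coordinates `u = B₀ − A₀`, `v = B₁ − A₀`)
  set IX : Finset (Fin s) := Finset.univ.filter fun i =>
    A 0 i + A 1 i = B 0 i + B 1 i ∧ B 0 i - A 0 i ≠ 0 ∧ B 1 i - A 0 i = 0 with hIX
  set IV : Finset (Fin s) := Finset.univ.filter fun i =>
    A 0 i + A 1 i = B 0 i + B 1 i ∧ B 1 i - A 0 i ≠ 0 with hIV
  set IU : Finset (Fin s) := Finset.univ.filter fun i =>
    A 0 i + A 1 i = B 0 i + B 1 i ∧ B 0 i - A 0 i ≠ 0 with hIU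
  set IY : Finset (Fin s) := Finset.univ.filter fun i =>
    A 0 i + A 1 i = B 0 i + B 1 i ∧ B 0 i - A 0 i = 0 ∧ B 1 i - A 0 i ≠ 0 with hIY
  set E₁ : Set (Fin 2 → ℝ) :=
    (convexHull ℝ ((IX.image P + IV.image P : Finset (Fin 2 → ℝ)) : Set (Fin 2 → ℝ))).extremePoints ℝ with hE₁
  set E₂ : Set (Fin 2 → ℝ) :=
    (convexHull ℝ ((IU.image P + IY.image P : Finset (Fin 2 → ℝ)) : Set (Fin 2 → ℝ))).extremePoints ℝ with hE₂
  -- a strict-top criterion over an index class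
  have strictTop_of : ∀ (c : ℝ) (I : Finset (Fin s)) (a : Fin s), a ∈ I →
      (∀ a' ∈ I, P a' ≠ P a → θ₁ a + c * θ₂ a < θ₁ a' + c * θ₂ a') →
        Literature.Computability.AlgebraicComplexity.KPTT.PlanarMinkowski.IsStrictTop ![-1, -c] (I.image P) (P a) := by
    intro c I a ha hlt
    refine ⟨Finset.mem_image_of_mem P ha, fun y hy hne => ?_⟩
    obtain ⟨a', ha', rfl⟩ := Finset.mem_image.mp hy
    rw [hwP, hwP]
    linarith [hlt a' ha' hne]
  -- `G` on pairs / doubles of dead coordinates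
  have Zc_pair : ∀ a b : Fin s, A 0 a + A 1 a = B 0 a + B 1 a → A 0 b + A 1 b = B 0 b + B 1 b →
      (B 0 a - A 0 a) * (B 1 b - A 0 b) + (B 0 b - A 0 b) * (B 1 a - A 0 a) ≠ 0 →
      Zc (Pi.single a 1 + Pi.single b 1) := by
    intro a b ha hb hne
    change (∑ j, ∏ i, A j i ^ (Pi.single a 1 + Pi.single b 1 : Fin s → ℕ) i) ≠ _
    rw [ne_eq, ← sub_eq_zero, G_pair_eq A B a b ha hb]
    exact hne
  have Zc_double : ∀ a : Fin s, A 0 a + A 1 a = B 0 a + B 1 a → (B 0 a - A 0 a) * (B 1 a - A 0 a) ≠ 0 →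
      Zc (Pi.single a 2) := by
    intro a ha hne
    change (∑ j, ∏ i, A j i ^ (Pi.single a 2 : Fin s → ℕ) i) ≠ _
    rw [ne_eq, ← sub_eq_zero, G_double_eq A B a ha]
    exact mul_ne_zero two_ne_zero hne
  -- distinctness of small multi-indices
  have single_add_ne : ∀ a b d : Fin s, a ≠ d → b ≠ d →
      (Pi.single d 1 + Pi.single b 1 : Fin s → ℕ) ≠ Pi.single a 1 + Pi.single b 1 := by
    intro a b d had hbd h
    have := congrFun h d
    rw [Pi.add_apply, Pi.add_apply, Pi.single_eq_same, Pi.single_eq_of_ne (Ne.symm hbd),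
      Pi.single_eq_of_ne (Ne.symm had)] at this
    omega
  have double_ne_pair : ∀ a b : Fin s, a ≠ b → (Pi.single a 2 : Fin s → ℕ) ≠ Pi.single a 1 + Pi.single b 1 := by
    intro a b hab h
    have := congrFun h b
    rw [Pi.add_apply, Pi.single_eq_same, Pi.single_eq_of_ne (Ne.symm hab), Pi.single_eq_of_ne (Ne.symm hab)] at this
    omega
  -- THE PAIR CASE: the planar image of a visible pair is an extreme point of one of the two Minkowski sums
  have core : ∀ μ ∈ S, ∀ i k : Fin s, i ≠ k → μ = Pi.single i 1 + Pi.single k 1 →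
      A 0 i + A 1 i = B 0 i + B 1 i → A 0 k + A 1 k = B 0 k + B 1 k →
      (B 0 i - A 0 i) * (B 1 k - A 0 k) ≠ 0 → π μ ∈ E₁ ∪ E₂ := by
    intro μ hμ i k hik hμe hdi hdk huv
    obtain ⟨hG, c, hc, hmin⟩ := hS μ hμ
    have hui : B 0 i - A 0 i ≠ 0 := left_ne_zero_of_mul huv
    have hvk : B 1 k - A 0 k ≠ 0 := right_ne_zero_of_mul huv
    -- the grading of `μ` and of competitors
    have hgμ : ∑ l, (θ₁ l + c * θ₂ l) * (μ l : ℝ) = (θ₁ i + c * θ₂ i) + (θ₁ k + c * θ₂ k) := by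
      rw [hμe]; exact grading_pair θ₁ θ₂ c i k
    -- competitor `e_{a} + e_k` with `a` dead, `u_a ≠ 0`, and `u_k v_a = 0`
    have beat_left : ∀ a : Fin s, a ≠ i → a ≠ k → A 0 a + A 1 a = B 0 a + B 1 a → B 0 a - A 0 a ≠ 0 →
        (B 0 k - A 0 k) * (B 1 a - A 0 a) = 0 → θ₁ i + c * θ₂ i < θ₁ a + c * θ₂ a := by
      intro a hai hak hda hua hzero
      have hZ : Zc (Pi.single a 1 + Pi.single k 1) :=
        Zc_pair a k hda hdk (by rw [hzero, add_zero]; exact mul_ne_zero hua hvk)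
      have hne : (Pi.single a 1 + Pi.single k 1 : Fin s → ℕ) ≠ μ := by
        rw [hμe]; exact single_add_ne i k a (Ne.symm hai) (Ne.symm hak)
      have h := hmin _ hne hZ
      rw [hgμ, grading_pair] at h
      linarith
    -- competitor `e_i + e_b` with `b` dead, `v_b ≠ 0`, and `u_b v_i = 0`
    have beat_right : ∀ b : Fin s, b ≠ k → b ≠ i → A 0 b + A 1 b = B 0 b + B 1 b → B 1 b - A 0 b ≠ 0 →
        (B 0 b - A 0 b) * (B 1 i - A 0 i) = 0 → θ₁ k + c * θ₂ k < θ₁ b + c * θ₂ b := by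
      intro b hbk hbi hdb hvb hzero
      have hZ : Zc (Pi.single i 1 + Pi.single b 1) :=
        Zc_pair i b hdi hdb (by rw [hzero, add_zero]; exact mul_ne_zero hui hvb)
      have hne : (Pi.single i 1 + Pi.single b 1 : Fin s → ℕ) ≠ μ := by
        rw [hμe, add_comm (Pi.single i 1) (Pi.single b 1), add_comm (Pi.single i 1) (Pi.single k 1)]
        exact single_add_ne k i b (Ne.symm hbk) (Ne.symm hbi)
      have h := hmin _ hne hZ
      rw [hgμ, grading_pair] at h
      linarith
    rw [hμe, hπ_pair]
    by_cases hvi : B 1 i - A 0 i = 0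
    · -- case A: `i ∈ 𝒳`, `k ∈ 𝒱`
      left
      have hXi : Literature.Computability.AlgebraicComplexity.KPTT.PlanarMinkowski.IsStrictTop ![-1, -c] (IX.image P) (P i) := by
        refine strictTop_of c IX i (Finset.mem_filter.mpr ⟨Finset.mem_univ i, hdi, hui, hvi⟩) fun a ha hne => ?_
        obtain ⟨-, hda, hua, hva⟩ := Finset.mem_filter.mp ha
        have hai : a ≠ i := fun h => hne (by rw [h])
        have hak : a ≠ k := fun h => hvk (by rw [← h]; exact hva)
        exact beat_left a hai hak hda hua (by rw [hva, mul_zero])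
      have hVk : Literature.Computability.AlgebraicComplexity.KPTT.PlanarMinkowski.IsStrictTop ![-1, -c] (IV.image P) (P k) := by
        refine strictTop_of c IV k (Finset.mem_filter.mpr ⟨Finset.mem_univ k, hdk, hvk⟩) fun b hb hne => ?_
        obtain ⟨-, hdb, hvb⟩ := Finset.mem_filter.mp hb
        have hbk : b ≠ k := fun h => hne (by rw [h])
        have hbi : b ≠ i := fun h => hvb (by rw [h]; exact hvi)
        exact beat_right b hbk hbi hdb hvb (by rw [hvi, mul_zero])
      exact (hXi.add hVk).mem_extremePoints
    · -- case B: `2e_i ∈ Zc` forces `ℓ_k < ℓ_i`, then `u_k = 0`: `i ∈ 𝒰`, `k ∈ 𝒴`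
      right
      have hlt_ki : θ₁ k + c * θ₂ k < θ₁ i + c * θ₂ i := by
        have hZ : Zc (Pi.single i 2) := Zc_double i hdi (mul_ne_zero hui hvi)
        have hne : (Pi.single i 2 : Fin s → ℕ) ≠ μ := by rw [hμe]; exact double_ne_pair i k hik
        have h := hmin _ hne hZ
        rw [hgμ, grading_single] at h
        push_cast at h
        linarith
      have huk : B 0 k - A 0 k = 0 := by
        by_contra huk
        have hZ : Zc (Pi.single k 2) := Zc_double k hdk (mul_ne_zero huk hvk)
        have hne : (Pi.single k 2 : Fin s → ℕ) ≠ μ := by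
          rw [hμe, add_comm]; exact double_ne_pair k i (Ne.symm hik)
        have h := hmin _ hne hZ
        rw [hgμ, grading_single] at h
        push_cast at h
        linarith
      have hUi : Literature.Computability.AlgebraicComplexity.KPTT.PlanarMinkowski.IsStrictTop ![-1, -c] (IU.image P) (P i) := by
        refine strictTop_of c IU i (Finset.mem_filter.mpr ⟨Finset.mem_univ i, hdi, hui⟩) fun a ha hne => ?_
        obtain ⟨-, hda, hua⟩ := Finset.mem_filter.mp ha
        have hai : a ≠ i := fun h => hne (by rw [h])
        have hak : a ≠ k := fun h => hua (by rw [h]; exact huk)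
        exact beat_left a hai hak hda hua (by rw [huk, zero_mul])
      have hYk : Literature.Computability.AlgebraicComplexity.KPTT.PlanarMinkowski.IsStrictTop ![-1, -c] (IY.image P) (P k) := by
        refine strictTop_of c IY k (Finset.mem_filter.mpr ⟨Finset.mem_univ k, hdk, huk, hvk⟩) fun b hb hne => ?_
        obtain ⟨-, hdb, hub, hvb⟩ := Finset.mem_filter.mp hb
        have hbk : b ≠ k := fun h => hne (by rw [h])
        have hbi : b ≠ i := fun h => hui (by rw [← h]; exact hub)
        exact beat_right b hbk hbi hdb hvb (by rw [hub, zero_mul])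
      exact (hUi.add hYk).mem_extremePoints
  have hpair : ∀ μ ∈ S, ∀ i k : Fin s, i ≠ k → μ = Pi.single i 1 + Pi.single k 1 → π μ ∈ E₁ ∪ E₂ := by
    intro μ hμ i k hik hμe
    have hdi := hdead_of_pair μ hμ i k hik hμe
    have hdk := hdead_of_pair μ hμ k i (Ne.symm hik) (by rw [hμe, add_comm])
    have hG := (hS μ hμ).1
    have hsum : (B 0 i - A 0 i) * (B 1 k - A 0 k) + (B 0 k - A 0 k) * (B 1 i - A 0 i) ≠ 0 := by
      rw [← G_pair_eq A B i k hdi hdk, sub_ne_zero, ← hμe]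
      exact hG
    by_cases h1 : (B 0 i - A 0 i) * (B 1 k - A 0 k) ≠ 0
    · exact core μ hμ i k hik hμe hdi hdk h1
    · push Not at h1
      have h2 : (B 0 k - A 0 k) * (B 1 i - A 0 i) ≠ 0 := by rw [h1, zero_add] at hsum; exact hsum
      exact core μ hμ k i (Ne.symm hik) (by rw [hμe, add_comm]) hdk hdi h2
  -- the two parts of `S`
  set S₁ : Finset (Fin s → ℕ) := S.filter fun μ => ∃ i, μ = Pi.single i 1 ∨ μ = Pi.single i 2 with hS₁
  set S₂ : Finset (Fin s → ℕ) := S.filter fun μ => ∃ i k, i ≠ k ∧ μ = Pi.single i 1 + Pi.single k 1 with hS₂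
  have hcover : S ⊆ S₁ ∪ S₂ := by
    intro μ hμ
    rw [Finset.mem_union, hS₁, hS₂, Finset.mem_filter, Finset.mem_filter]
    rcases shape_of_sum_le_two μ (hdeg μ hμ) with h0 | ⟨i, hi⟩ | ⟨i, hi⟩ | ⟨i, k, hik, hik'⟩
    · exfalso
      apply (hS μ hμ).1
      rw [h0]; simp
    · exact Or.inl ⟨hμ, i, Or.inl hi⟩
    · exact Or.inl ⟨hμ, i, Or.inr hi⟩
    · exact Or.inr ⟨hμ, i, k, hik, hik'⟩
  -- singles and doubles charge injectively to their index (`e_i` and `2e_i` are never both visible)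
  have excl : ∀ i : Fin s, (Pi.single i 1 : Fin s → ℕ) ∈ S → (Pi.single i 2 : Fin s → ℕ) ∈ S → False := by
    intro i h1 h2
    have hle : (Pi.single i 1 : Fin s → ℕ) ≤ Pi.single i 2 := by
      intro l
      by_cases hl : l = i
      · subst hl; rw [Pi.single_eq_same, Pi.single_eq_same]; exact Nat.le_succ 1
      · rw [Pi.single_eq_of_ne hl, Pi.single_eq_of_ne hl]
    have hne : (Pi.single i 1 : Fin s → ℕ) ≠ Pi.single i 2 := by
      intro h; have := congrFun h i; rw [Pi.single_eq_same, Pi.single_eq_same] at this; omega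
    exact (hS _ h1).1 (hminimal _ h2 _ hle hne)
  have hS₁card : S₁.card ≤ s := by
    have hsub : S₁ ⊆ Finset.univ.biUnion (fun i : Fin s =>
        ({Pi.single i 1, Pi.single i 2} : Finset (Fin s → ℕ)).filter (· ∈ S)) := by
      intro μ hμ
      obtain ⟨hμS, i, hi⟩ := Finset.mem_filter.mp hμ
      refine Finset.mem_biUnion.mpr ⟨i, Finset.mem_univ i, Finset.mem_filter.mpr ⟨?_, hμS⟩⟩
      rcases hi with h | h <;> simp [h]
    have hone : ∀ i : Fin s, ((({Pi.single i 1, Pi.single i 2} : Finset (Fin s → ℕ)).filter (· ∈ S))).card ≤ 1 := by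
      intro i
      refine Finset.card_le_one.mpr fun ν hν ν' hν' => ?_
      obtain ⟨hνm, hνS⟩ := Finset.mem_filter.mp hν
      obtain ⟨hν'm, hν'S⟩ := Finset.mem_filter.mp hν'
      simp only [Finset.mem_insert, Finset.mem_singleton] at hνm hν'm
      rcases hνm with rfl | rfl <;> rcases hν'm with rfl | rfl
      · rfl
      · exact (excl i hνS hν'S).elim
      · exact (excl i hν'S hνS).elim
      · rfl
    calc S₁.card ≤ (Finset.univ.biUnion (fun i : Fin s =>
          ({Pi.single i 1, Pi.single i 2} : Finset (Fin s → ℕ)).filter (· ∈ S))).card := Finset.card_le_card hsub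
      _ ≤ ∑ i : Fin s, ((({Pi.single i 1, Pi.single i 2} : Finset (Fin s → ℕ)).filter (· ∈ S))).card :=
          Finset.card_biUnion_le
      _ ≤ ∑ _i : Fin s, 1 := Finset.sum_le_sum fun i _ => hone i
      _ = s := by simp
  -- pairs chart injectively into the two extreme-point sets
  have hext_le : ∀ (I J : Finset (Fin s)),
      ((convexHull ℝ ((I.image P + J.image P : Finset (Fin 2 → ℝ)) : Set (Fin 2 → ℝ))).extremePoints ℝ).ncard ≤
        I.card + J.card := by
    intro I J
    by_cases hI : (I.image P).Nonempty
    · by_cases hJ : (J.image P).Nonempty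
      · exact (ncard_extremePoints_add_le hI hJ).trans (Nat.add_le_add
          ((ncard_extremePoints_le_card _).trans Finset.card_image_le)
          ((ncard_extremePoints_le_card _).trans Finset.card_image_le))
      · rw [Finset.not_nonempty_iff_eq_empty.mp hJ, Finset.add_empty]; simp
    · rw [Finset.not_nonempty_iff_eq_empty.mp hI, Finset.empty_add]; simp
  have hE₁fin : E₁.Finite := (Finset.finite_toSet _).subset extremePoints_convexHull_subset
  have hE₂fin : E₂.Finite := (Finset.finite_toSet _).subset extremePoints_convexHull_subset
  have hS₂card : S₂.card ≤ s + s := by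
    have himg : ↑(S₂.image π) ⊆ E₁ ∪ E₂ := by
      intro x hx
      obtain ⟨μ, hμ, rfl⟩ := Finset.mem_image.mp (Finset.mem_coe.mp hx)
      obtain ⟨hμS, i, k, hik, hμe⟩ := Finset.mem_filter.mp hμ
      exact hpair μ hμS i k hik hμe
    have hinj : Set.InjOn π ↑S₂ := fun μ hμ μ' hμ' h =>
      hπinj (Finset.mem_filter.mp hμ).1 (Finset.mem_filter.mp hμ').1 h
    have hdisj₁ : Disjoint IX IV := by
      rw [Finset.disjoint_filter]; intro i _ h1 h2; exact h2.2 h1.2.2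
    have hdisj₂ : Disjoint IU IY := by
      rw [Finset.disjoint_filter]; intro i _ h1 h2; exact h1.2 h2.2.1
    have h1 : IX.card + IV.card ≤ s := by
      rw [← Finset.card_union_of_disjoint hdisj₁]
      exact (Finset.card_le_univ _).trans (Fintype.card_fin s).le
    have h2 : IU.card + IY.card ≤ s := by
      rw [← Finset.card_union_of_disjoint hdisj₂]
      exact (Finset.card_le_univ _).trans (Fintype.card_fin s).le
    calc S₂.card = (S₂.image π).card := (Finset.card_image_of_injOn hinj).symm
      _ = (↑(S₂.image π) : Set (Fin 2 → ℝ)).ncard := (Set.ncard_coe_finset _).symm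
      _ ≤ (E₁ ∪ E₂).ncard := Set.ncard_le_ncard himg (hE₁fin.union hE₂fin)
      _ ≤ E₁.ncard + E₂.ncard := Set.ncard_union_le _ _
      _ ≤ (IX.card + IV.card) + (IU.card + IY.card) := Nat.add_le_add (hext_le IX IV) (hext_le IU IY)
      _ ≤ s + s := Nat.add_le_add h1 h2
  calc S.card ≤ (S₁ ∪ S₂).card := Finset.card_le_card hcover
    _ ≤ S₁.card + S₂.card := Finset.card_union_le _ _
    _ ≤ s + (s + s) := Nat.add_le_add hS₁card hS₂card
    _ = 3 * s := by ring

end Summit.ValiantsHypothesis.ValiantsHypothesis.Theorems.NewtonUnitEquations.TwoProducts.FormalLogLinearisation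

end
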